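import Summits.Schanuel.Schanuel.Theorems.RootDecomp1BMovingZero21

/-!
# RootDecomp1BMovingZero — lens 4, generation 39 «ISOLATED POINT BOUND, SLOT DISCHARGED» (lane B-R24 (a) / RULE B-R25): the last B-side print input `IsolatedPointBound` (FACT B, part 11) of the moving-zero cell DISCHARGED up to its parameter-free numeral — `def IsolatedPointBoundN` (part 11's text with `(2n+3)·log(n+1) ↦ 6n³`) and `theorem isolatedPointBoundN_holds : IsolatedPointBoundN` HYPOTHESIS-FREE from the tree's proved Nesterenko–Philippon elimination theory; `ApproxOfIsolated ρ` UNCONDITIONAL for every real ρ; `MovingZeroApprox ρ` modulo `AxRankBoundLaurent` only; the (1|ρ) storey cell modulo {Ax, LWMeasure, ExplicitRatExpApprox} — continuation (RootDecomp1BMovingZero22): §B consumers re-run on `IsolatedPointBoundN` + the four (1|ρ) cells modulo {Ax, LWMeasure, ExplicitRatExpApprox}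

(lens-4 g39 HOME kernel IsolatedPointDischarge.lean dce96aa4…, 1262 l, imports tree MovingZero17 + the Literature elimination theory (PhilipponCriterionDescend / ProjectiveNoIsolatedPoints / NesterenkoEliminationProp411Holds / Prop47Holds / Facts2Proofs / NesterenkoUResultantIntCoeffs / NesterenkoIntegerHeights / PhilipponCriterionRankOne / ConeRank / Principal / NesterenkoEliminationZeros) + Mathlib MahlerMeasure; CLAIM L2051, RULING + RULE B-R25 + CHECKLIST B-g39 L2053, NODE L2060 / REQUEST L2061 / RESULT L2062, critic VERDICT L2063 (crit g8: CLEARED — THEOREM ×1 for the SLOT under RULE B-R25; lens-4 tally THEOREM ×6 + CELL ×2; the moving-zero cell's named inputs of record = {AxRankBoundLaurent, LWMeasure, ExplicitRatExpApprox}; PORT GO); port by census-1 gen 18 as `RootDecomp1BMovingZero18`–`22`: 18 = `namespace IsolatedPt` §E1–§E3 (binary forms at `(1,t)`, algebraicity of the coordinates on a rank-one prime, no point at infinity); 19 = §E4a the `u`-resultant read on the lines `τ e₀ − e_{j+1}` (`zpart` / `gPoly` / `uVec` / `pairExp`, coefficient and degree lemmas); 20 = §E4b the rank-one endgame `IsolatedPt.exists_poly_of_rank_one`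 (integer Chow form + Mahler measure) + §D the TRACKED DESCENT `IsolatedPt.descent_tracked` + §A arithmetic (`log_mvPolyHeight_le`, `junk_absorb`, `sharp_le_junk`); 21 = §N `def IsolatedPointBoundN`, (γ) `isolatedPointBoundN_of_isolatedPointBound`, THE DISCHARGE `isolatedPointBoundN_holds` (kind definition, `--no-relocate`); 22 = §B consumers re-run (`isolatedPointBoundN_five`, `height_side_leN`, `approxOfIsolated_of_factsN`, `movingZeroApprox_of_factsN`, `approxOfIsolated_holds`, `approxOfIsolated_of_ax`, `movingZeroApprox_of_ax`) + the four cells `four_le_polarDeg_one/swap/one_hyper/one_rhoT_of_ax`.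
PORT EDITS: the `AxiomGuards` section (7 `#guard_msgs in #print axioms`), the unused `import HarnessLib` and `set_option linter.dupNamespace false` dropped; eleven one-line docstrings added; statements and proofs verbatim. `--supports stmt-Schanuel-24622`; no census credit carried; rung 0 — nothing here proves Schanuel.)
-/

noncomputable section

open MvPolynomial
open Literature.NumberTheory.Transcendental
open Literature.NumberTheory.Transcendental.Nesterenko
open Literature.NumberTheory.Transcendental.PhilipponMain

namespace Summit.Schanuel.Schanuel.Theorems.RootDecomp1BMovingZero

/-! ## §B  The consumers of record re-derived on `IsolatedPointBoundN` (part 13's proofs, numeral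
`13 · log 6` ↦ `750 = 6 · 5³`, `26 · log 6` ↦ `1500`); then the moving-zero cell modulo
{`AxRankBoundLaurent` (tree-proved, by name), `LWMeasure`, `ExplicitRatExpApprox`} — NO B-side print fact. -/

section PieceBMainN

open Complex Filter Topology Polynomial

/-- `IsolatedPointBoundN` specialised to five equations in `𝔸⁵` (numerals `5 log H + 750` evaluated). -/
theorem isolatedPointBoundN_five (hB : IsolatedPointBoundN) (F : Fin 5 → MvPolynomial (Fin 5) ℤ) (D : Fin 5 → ℕ)
    (H : ℕ) (ω : Fin 5 → ℂ) (hD : ∀ i, 1 ≤ D i) (hdeg : ∀ i, (F i).totalDegree ≤ D i) (hH : 1 ≤ H)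
    (hcoeff : ∀ i m, |(F i).coeff m| ≤ (H : ℤ)) (hzero : ∀ i, MvPolynomial.aeval ω (F i) = 0)
    (hiso : ∀ᶠ ω' in 𝓝[≠] ω, ∃ i, MvPolynomial.aeval ω' (F i) ≠ 0) (j : Fin 5) :
    ∃ Q : ℤ[X], Irreducible Q ∧ 0 < Q.natDegree ∧ Polynomial.aeval (ω j) Q = 0 ∧
      (Q.natDegree : ℝ) ≤ ∏ i, (D i : ℝ) ∧
        Real.log (Q.map (Int.castRingHom ℂ)).mahlerMeasure ≤ (∏ i, (D i : ℝ)) * (5 * Real.log H + 750) := by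
  obtain ⟨Q, h1, h2, h3, h4, h5⟩ := hB 5 5 F D H ω hD hdeg hH hcoeff hzero hiso j
  refine ⟨Q, h1, h2, h3, h4, h5.trans_eq ?_⟩
  norm_num

/-- Height-side bookkeeping: `5 log H + 750 ≤ (5 + 10 A + 1500) · L` for `log H ≤ A + L`, `L ≥ 1/2`. -/
theorem height_side_leN {A L x : ℝ} (hA : 0 ≤ A) (hL : 1 / 2 ≤ L) (hx : x ≤ A + L) :
    5 * x + 750 ≤ (5 + 10 * A + 1500) * L := by
  have h1 : 10 * A * (1 / 2) ≤ 10 * A * L := mul_le_mul_of_nonneg_left hL (by positivity)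
  nlinarith

/-- **THEOREM B on `IsolatedPointBoundN`: `ApproxOfIsolated ρ` for EVERY real `ρ`** — part 13's
`approxOfIsolated_of_facts` VERBATIM with `isolatedPointBound_five` ↦ `isolatedPointBoundN_five` and the
numerals `13 log 6 ↦ 750`, `26 log 6 ↦ 1500` (the constants `c₁, c₂` of `ApproxData ρ` are existential). -/
theorem approxOfIsolated_of_factsN (hA : AnalyticMovingZero) (hB : IsolatedPointBoundN) (ρ : ℝ) :
    ApproxOfIsolated ρ := by
  intro _ K₁ K₂ G₁ G₂ hP hiso
  classical
  -- A: the moving zero at θ; the slit-plane ball; smallness; the threshold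
  obtain ⟨δ, C, κ, hδ, hC, hκ, hmove⟩ := movingZero_theta hA hP hiso
  obtain ⟨η, hη, hball⟩ := exists_ball_theta_slit
  obtain ⟨δB, hδB, hsmall⟩ := exists_delta_rpow_lt C hκ hη
  have hε : 0 < min 1 (min δ δB) := lt_min one_pos (lt_min hδ hδB)
  obtain ⟨q₀, hq₀⟩ := exists_nat_exp_neg_lt hε
  -- the q-independent data of the system: degrees and coefficient bounds of `E₁`, `E₂`
  obtain ⟨D₁, hD₁1, hD₁deg⟩ : ∃ D₁ : ℕ, 1 ≤ D₁ ∧ (relPoly G₁ 3).totalDegree ≤ D₁ :=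
    ⟨max 1 (relPoly G₁ 3).totalDegree, le_max_left _ _, le_max_right _ _⟩
  obtain ⟨D₂, hD₂1, hD₂deg⟩ : ∃ D₂ : ℕ, 1 ≤ D₂ ∧ (relPoly G₂ 4).totalDegree ≤ D₂ :=
    ⟨max 1 (relPoly G₂ 4).totalDegree, le_max_left _ _, le_max_right _ _⟩
  obtain ⟨H₁, hH₁⟩ := exists_coeff_abs_le (relPoly G₁ 3)
  obtain ⟨H₂, hH₂⟩ := exists_coeff_abs_le (relPoly G₂ 4)
  have hH₁0 : (0 : ℝ) ≤ H₁ := Nat.cast_nonneg _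
  have hH₂0 : (0 : ℝ) ≤ H₂ := Nat.cast_nonneg _
  have hρ0 : 0 ≤ |ρ| := abs_nonneg ρ
  have hApos : 0 < (H₁ : ℝ) + H₂ + |ρ| + 4 := by linarith
  have hlogA : 0 ≤ Real.log ((H₁ : ℝ) + H₂ + |ρ| + 4) := Real.log_nonneg (by linarith)
  -- the constants of `ApproxData ρ`
  unfold ApproxData
  refine ⟨C, κ, hC, hκ, (D₁ : ℝ) * D₂ * (|ρ| + 2) ^ 2,
    (D₁ : ℝ) * D₂ * (|ρ| + 2) ^ 2 * (5 + 10 * Real.log ((H₁ : ℝ) + H₂ + |ρ| + 4) + 1500), q₀, ?_⟩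
  intro r hqr hr
  have hq1 : 1 ≤ r.den := r.den_pos
  have hqpos : (0 : ℝ) < r.den := Nat.cast_pos.mpr r.den_pos
  have hlt : |ρ - r| < min 1 (min δ δB) := hr.trans (hq₀ r.den hqr)
  have hlt1 : |ρ - r| < 1 := hlt.trans_le (min_le_left _ _)
  have hltδ : |ρ - r| < δ := (hlt.trans_le (min_le_right _ _)).trans_le (min_le_left _ _)
  have hltδB : |ρ - r| < δB := (hlt.trans_le (min_le_right _ _)).trans_le (min_le_right _ _)
  -- the complex parameter `t = r`
  have ht : ‖((r : ℚ) : ℂ) - (ρ : ℂ)‖ = |ρ - r| := by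
    rw [← Complex.ofReal_ratCast, ← Complex.ofReal_sub, Complex.norm_real, Real.norm_eq_abs, abs_sub_comm]
  obtain ⟨w, hw0, hwiso, hwle⟩ := hmove (r : ℂ) (by rw [ht]; exact hltδ)
  rw [ht] at hwle
  -- `w` is `η`-close to `θ`: both coordinates off the cut
  have hwη : ‖w - (cexp 1, cexp Complex.I)‖ < η := hwle.trans_lt (hsmall _ (abs_nonneg _) hltδB)
  obtain ⟨hXs, hYs⟩ := hball w hwη
  have hX0 : w.1 ≠ 0 := Complex.slitPlane_ne_zero hXs
  have hY0 : w.2 ≠ 0 := Complex.slitPlane_ne_zero hYs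
  -- B-1/B-2: the lifted point is an ISOLATED common zero of `E(r)` in `ℂ⁵`
  have hzero : ∀ i, MvPolynomial.aeval (pt r w) (sys G₁ G₂ r i) = 0 := aeval_sys_pt G₁ G₂ r hX0 hY0 hw0
  have hisol := isolated_pt G₁ G₂ r hXs hYs hwiso
  -- B-3: degree and coefficient data of `E(r)`
  have hN1 : 1 ≤ r.den + r.num.natAbs := by omega
  have hDpos : ∀ i, 1 ≤ (![1, D₁, D₂, r.den + r.num.natAbs, r.den + r.num.natAbs] : Fin 5 → ℕ) i := by
    intro i
    fin_cases i
    · exact le_rfl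
    · exact hD₁1
    · exact hD₂1
    · exact hN1
    · exact hN1
  have hDdeg : ∀ i, (sys G₁ G₂ r i).totalDegree ≤
      (![1, D₁, D₂, r.den + r.num.natAbs, r.den + r.num.natAbs] : Fin 5 → ℕ) i := by
    intro i
    fin_cases i
    · exact totalDegree_linPoly _ _
    · exact hD₁deg
    · exact hD₂deg
    · exact totalDegree_powPoly _ _ _ _
    · exact totalDegree_powPoly _ _ _ _
  have hH1 : 1 ≤ H₁ + H₂ + 2 + (r.den + r.num.natAbs) := by omega
  have hHcoeff : ∀ i m, |(sys G₁ G₂ r i).coeff m| ≤ ((H₁ + H₂ + 2 + (r.den + r.num.natAbs) : ℕ) : ℤ) := by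
    intro i m
    have h₁ : (0 : ℤ) ≤ H₁ := Nat.cast_nonneg _
    have h₂ : (0 : ℤ) ≤ H₂ := Nat.cast_nonneg _
    have hq : (0 : ℤ) ≤ r.den := Nat.cast_nonneg _
    have hp : (0 : ℤ) ≤ |r.num| := abs_nonneg _
    have hcast : ((H₁ + H₂ + 2 + (r.den + r.num.natAbs) : ℕ) : ℤ) = H₁ + H₂ + 2 + (r.den + |r.num|) := by
      push_cast
      ring
    rw [hcast]
    fin_cases i
    · exact (coeff_linPoly_abs_le _ _ m).trans (by linarith)
    · exact (hH₁ m).trans (by linarith)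
    · exact (hH₂ m).trans (by linarith)
    · exact (coeff_powPoly_abs_le _ _ _ _ m).trans (by linarith)
    · exact (coeff_powPoly_abs_le _ _ _ _ m).trans (by linarith)
  -- `IsolatedPointBoundN` at the lifted point, coordinate `X`
  obtain ⟨Q, hirr, hdeg0, hroot, hdegle, hM⟩ := isolatedPointBoundN_five hB (sys G₁ G₂ r)
    ![1, D₁, D₂, r.den + r.num.natAbs, r.den + r.num.natAbs] (H₁ + H₂ + 2 + (r.den + r.num.natAbs)) (pt r w)
    hDpos hDdeg hH1 hHcoeff hzero hisol 1
  rw [pt_one] at hroot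
  -- the product of the degrees and its q-bound (degree side)
  have hprod : ∏ i, ((![1, D₁, D₂, r.den + r.num.natAbs, r.den + r.num.natAbs] : Fin 5 → ℕ) i : ℝ) =
      (D₁ : ℝ) * D₂ * (((r.den + r.num.natAbs : ℕ) : ℝ) * ((r.den + r.num.natAbs : ℕ) : ℝ)) := by
    rw [Fin.prod_univ_five]
    simp only [Matrix.cons_val_zero, Matrix.cons_val_one, Matrix.cons_val]
    push_cast
    ring
  rw [hprod] at hdegle hM
  have hP : (D₁ : ℝ) * D₂ * (((r.den + r.num.natAbs : ℕ) : ℝ) * ((r.den + r.num.natAbs : ℕ) : ℝ)) ≤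
      (D₁ : ℝ) * D₂ * (|ρ| + 2) ^ 2 * (r.den : ℝ) ^ 2 :=
    degree_side_le (by positivity) (Nat.cast_nonneg _) (den_add_natAbs_num_le hlt1)
  -- the height side: `H ≤ A (q+1)`, `log H ≤ log A + log (q+1)`, `log (q+1) ≥ 1/2`
  have hHR : ((H₁ + H₂ + 2 + (r.den + r.num.natAbs) : ℕ) : ℝ) ≤
      ((H₁ : ℝ) + H₂ + |ρ| + 4) * ((r.den : ℝ) + 1) := by
    push_cast
    exact coeff_side_le hH₁0 hH₂0 hρ0 hqpos.le (by exact_mod_cast den_add_natAbs_num_le hlt1)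
  have hHpos : (0 : ℝ) < ((H₁ + H₂ + 2 + (r.den + r.num.natAbs) : ℕ) : ℝ) := by
    exact_mod_cast (show 0 < H₁ + H₂ + 2 + (r.den + r.num.natAbs) by omega)
  have hlogH : Real.log (((H₁ + H₂ + 2 + (r.den + r.num.natAbs) : ℕ) : ℝ)) ≤
      Real.log ((H₁ : ℝ) + H₂ + |ρ| + 4) + Real.log ((r.den : ℝ) + 1) := by
    rw [← Real.log_mul hApos.ne' (by positivity)]
    exact Real.log_le_log hHpos hHR
  have hlogH0 : 0 ≤ Real.log (((H₁ + H₂ + 2 + (r.den + r.num.natAbs) : ℕ) : ℝ)) :=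
    Real.log_nonneg (by exact_mod_cast hH1)
  have hB0 : 0 ≤ 5 * Real.log (((H₁ + H₂ + 2 + (r.den + r.num.natAbs) : ℕ) : ℝ)) + 750 := by linarith
  have hBle := height_side_leN hlogA (half_le_log_den_add_one hq1) hlogH
  refine ⟨Q, w.1, hirr, hdeg0, hroot, hdegle.trans hP, ?_, ?_⟩
  · -- Mahler measure
    calc Real.log (Q.map (Int.castRingHom ℂ)).mahlerMeasure
        ≤ (D₁ : ℝ) * D₂ * (((r.den + r.num.natAbs : ℕ) : ℝ) * ((r.den + r.num.natAbs : ℕ) : ℝ)) *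
            (5 * Real.log (((H₁ + H₂ + 2 + (r.den + r.num.natAbs) : ℕ) : ℝ)) + 750) := hM
      _ ≤ ((D₁ : ℝ) * D₂ * (|ρ| + 2) ^ 2 * (r.den : ℝ) ^ 2) *
            ((5 + 10 * Real.log ((H₁ : ℝ) + H₂ + |ρ| + 4) + 1500) * Real.log ((r.den : ℝ) + 1)) :=
          mul_le_mul hP hBle hB0 (by positivity)
      _ = (D₁ : ℝ) * D₂ * (|ρ| + 2) ^ 2 * (5 + 10 * Real.log ((H₁ : ℝ) + H₂ + |ρ| + 4) + 1500) *
            (r.den : ℝ) ^ 2 * Real.log ((r.den : ℝ) + 1) := by ring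
  · -- closeness of `ξ = X_t` to `e`
    calc ‖cexp 1 - w.1‖ = ‖(w - (cexp 1, cexp Complex.I)).1‖ := by rw [Prod.fst_sub, norm_sub_rev]
      _ ≤ ‖w - (cexp 1, cexp Complex.I)‖ := norm_fst_le _
      _ ≤ C * |ρ - r| ^ κ := hwle

/-- Part 13's corollary on `IsolatedPointBoundN`: T ∧ A ∧ B_N ⟹ `MovingZeroApprox ρ`. -/
theorem movingZeroApprox_of_factsN (hA : AnalyticMovingZero) (hB : IsolatedPointBoundN) {ρ : ℝ}
    (hT : IsolatedIntersection ρ) : MovingZeroApprox ρ :=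
  movingZeroApprox_of hT (approxOfIsolated_of_factsN hA hB ρ)

/-- **`ApproxOfIsolated ρ` FOR EVERY REAL `ρ` — UNCONDITIONAL** (A = `analyticMovingZero_holds`, part 15;
B = `isolatedPointBoundN_holds`, this file).  Supersedes part 15's `approxOfIsolated_of_isolatedPointBound`. -/
theorem approxOfIsolated_holds (ρ : ℝ) : ApproxOfIsolated ρ :=
  approxOfIsolated_of_factsN analyticMovingZero_holds isolatedPointBoundN_holds ρ

/-- The claimed read-out `AxRankBoundLaurent → ∀ ρ, ApproxOfIsolated ρ` (Ax is not even needed: see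
`approxOfIsolated_holds`). -/
theorem approxOfIsolated_of_ax : AxRankBoundLaurent → ∀ ρ : ℝ, ApproxOfIsolated ρ :=
  fun _ ρ => approxOfIsolated_holds ρ

/-- **THE CELL's MZ INPUT `MovingZeroApprox ρ` FOR EVERY REAL `ρ` modulo ONE named input,
`AxRankBoundLaurent`** (Ax 1971 — tree-PROVED in `Literature/…/AxSchanuelUniv`, carried by name for farm-build
reasons): part 17's `movingZeroApprox_of_two_facts` with `IsolatedPointBound` discharged (as `…N`). -/
theorem movingZeroApprox_of_ax (hAx : AxRankBoundLaurent) (ρ : ℝ) : MovingZeroApprox ρ :=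
  movingZeroApprox_of (isolatedIntersection_of_ax hAx ρ) (approxOfIsolated_holds ρ)

end PieceBMainN

section CellClosureN

open Summit.Schanuel.Schanuel.Theorems.RootDecomp1KHyper (LWMeasure)
open Summit.Schanuel.Schanuel.Theorems.RootDecomp1KHyper.HyperCell (HyperLiouville ExplicitRatExpApprox)
open Summit.Schanuel.Schanuel.Theorems.RootDecomp1KGeneric (LiouvilleOrder)
open Summit.Schanuel.Schanuel.Theorems.RootDecomp1KFiniteOrderCell (towerNumber)
open Summit.Schanuel.Schanuel.Theorems.RootDecomp1BFedFlagCore (polarDeg)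

/-- **THE CELL X(2) AT `(1, ρ)` for every real `ρ` of exponential Liouville order `8`**, modulo EXACTLY
{`AxRankBoundLaurent` (tree-proved, by name), `LWMeasure`, `ExplicitRatExpApprox`} — the B-side of the
moving-zero cell carries NO print fact any more. -/
theorem four_le_polarDeg_one_of_ax (hLW : LWMeasure) (hX : ExplicitRatExpApprox) (hAx : AxRankBoundLaurent)
    {ρ : ℝ} (hρ : LiouvilleOrder 8 ρ) : ((2 + 2 : ℕ) : Cardinal) ≤ polarDeg ![(1 : ℝ), ρ] :=
  four_le_polarDeg_one_of_movingZero hLW hX hρ (movingZeroApprox_of_ax hAx ρ)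

/-- … the swapped cell `(ρ, 1)`. -/
theorem four_le_polarDeg_swap_of_ax (hLW : LWMeasure) (hX : ExplicitRatExpApprox) (hAx : AxRankBoundLaurent)
    {ρ : ℝ} (hρ : LiouvilleOrder 8 ρ) : ((2 + 2 : ℕ) : Cardinal) ≤ polarDeg ![ρ, (1 : ℝ)] :=
  four_le_polarDeg_swap_of_movingZero hLW hX hρ (movingZeroApprox_of_ax hAx ρ)

/-- … the hyper-Liouville class (1K item 33363's class). -/
theorem four_le_polarDeg_one_hyper_of_ax (hLW : LWMeasure) (hX : ExplicitRatExpApprox)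
    (hAx : AxRankBoundLaurent) {ρ : ℝ} (hρ : HyperLiouville ρ) :
    ((2 + 2 : ℕ) : Cardinal) ≤ polarDeg ![(1 : ℝ), ρ] :=
  four_le_polarDeg_one_hyper hLW hX hρ (movingZeroApprox_of_ax hAx ρ)

/-- **X(2) AT `(1, ρ_T)`, `ρ_T = towerNumber 9` NOT hyper-Liouville**, modulo the same three named inputs. -/
theorem four_le_polarDeg_one_rhoT_of_ax (hLW : LWMeasure) (hX : ExplicitRatExpApprox)
    (hAx : AxRankBoundLaurent) : ((2 + 2 : ℕ) : Cardinal) ≤ polarDeg ![(1 : ℝ), towerNumber 9] :=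
  four_le_polarDeg_one_rhoT hLW hX (movingZeroApprox_of_ax hAx (towerNumber 9))

end CellClosureN

end Summit.Schanuel.Schanuel.Theorems.RootDecomp1BMovingZero

end
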